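import Summits.QuantumFields.YangMills.Theorems.LangevinControlUVFemtoCurvatureSkewnessCRatioTransportDefsE

/-!
# Route `LangevinControlUV`, crux `FemtoCurvatureSkewnessC` (stmt-QuantumFields-16205), line `ratio-transport`: vocabulary (F) —
# the PROMOTABLE forms behind the stubs: femto continuum PROFILE (engine side) and fixed-torus TREE DOMINANCE (anchor side)

Lead `prover-line-stmt-QuantumFields-16205-c2-0` (line lead, cycle 3, 2026-08-16), companion (F) of the route-posited vocabulary files
`…CRatioTransportDefs.lean` (p121740), `…DefsB.lean` (p123565), `…DefsC.lean` (p125065), `…DefsD.lean` (p126481), `…DefsE.lean` (p127471),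
typing the minimal named statements that the three stub-workers of wave 3 (stubs E_v, E_s, A of skeleton v4.2; all `stub-blocked`, no
tree / Literature fact) identified and kernel-checked as SUFFICIENT for their stubs.  Route-posited `def … : Prop`s only; NOTHING is
asserted; none is a literature fact; none restates the crux.  The implications are proved in the companion proof file
`LangevinControlUVFemtoCurvatureSkewnessCProfileBridges.lean` (this lead).

* `FemtoContinuumProfile r a` / `ProfileEngine` — ENGINE SIDE, ONE statement for E_c ∧ E_v ∧ E_s: along an engine-chosen continuous
  positive map `a` dominated by the hypothesis map `a₀`, the femto values `u(L, β, n)` of the tree-normalised skewness ratio are uniformly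
  approximated by a profile `Φ(t, θ)` of the physical separation `t = n·a(β)` and the aspect fraction `θ = n/L`, jointly continuous on the
  COMPACT rectangle `[0, ℓ] × [0, 1/8]` (edge `θ = 0`: the large-box limit; edge `t = 0`: the asymptotically free short-distance limit;
  the sup-approximation: the femto continuum limit of `u` along the step-scaling map).  Heine–Cantor on the rectangle gives the volume
  modulus, the large-aspect-ratio Cauchy property and the separation modulus; equality of `(t, θ)` at the two ends of an `M`-adic
  `a`-chain gives the two-ended cutoff transport: `profileEngine_engineQ : ProfileEngine → RatioTransportEngineQ` (bridges file).  The map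
  MUST be engine-chosen (`∃ a, Dominated a a₀`): along a boundedly wiggling package map `θ(β)·a` the sup-approximation is false-shaped,
  while the three stubs it serves read `a` only through the femto guard (transfer lemmas `*_of_dominated`).  STRONGER than the v4.2 stubs
  (it asserts continuity of the profile up to the edges `t = 0`, `θ = 0`, which the M-adic descent never uses) — offered as the natural
  deliverable SHAPE of a continuum-limit engine, not as a weakening.
* `FixedTorusTreeDominance r` / `AnchorsTreeDominance` — ANCHOR SIDE: on every fixed torus `L₀ ≥ 8n₀`, eventually as `β → ∞`, `κ₃` and
  `Cov_axis` are within a FIXED relative error `θ < 1` of the tree forms `8dλ³G_a²G_d`, `2dλ²G_a²` for SOME coupling factor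
  `λ = λ(L₀, β, n₀) > 0` — no limits, no rate, no knowledge of the constant-mode (toron) law (`θ` absorbs the `O((n₀/L₀)⁴) ≤ O(8⁻⁴)`
  zero-mode terms).  `anchors_of_treeDominance : AnchorsTreeDominance → Anchors` (`λ`, `G_a`, `G_d` cancel in the ratio;
  `u₀ = (1−θ)·8d/((1+θ)·2d)^{3/2}`); it is the fixed-torus shadow of the sibling line's `PressureDominance`
  (`treeDominance_of_pressureDominance`, via the landed `pressureCGF_holds`), hence `anchors_of_markedCouplingDominance :
  MarkedCouplingDominance → Anchors`.  Wave-3 risk analysis (stub A worker): for `SU(2)` on a PERIODIC 4-torus the constant-mode sector is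
  log-divergent in `d = 4` (valley measure `dρ/ρ`, Austing–Wheater 2001), so the limits-with-value form `FixedTorusLeadingOrder` (`…DefsB`)
  asks for weak convergence of the constant-mode law (rate `1/log β`) that the line never uses; the FLOOR / fixed-relative-error forms
  (`FixedTorusAnchors`, `FixedTorusTreeDominance`) are insensitive to it — recommend promoting `AnchorsTreeDominance`, not `AnchorsLeadingOrder`.
-/

set_option autoImplicit false

noncomputable section

namespace Summit.QuantumFields.YangMills.Cruxes.FemtoCurvatureSkewnessC.RatioTransport

open MeasureTheory Filter Topology
open Literature.MathematicalPhysics.QuantumFieldTheory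
open Summit.QuantumFields.YangMills.Theorems.FemtoCurvatureSkewness.Negative (kappa3 TwoPointPackage)
open Summit.QuantumFields.YangMills.Cruxes.FemtoCurvatureSkewness.CouplingCubicResponse
  (covAxis torusPropAxis torusPropDiag)

section Forms

variable {G : Type} [Group G] [TopologicalSpace G] [IsTopologicalGroup G] [CompactSpace G]
  [MeasurableSpace G] [BorelSpace G]

/-- **Femto continuum profile of the skewness ratio along the unit map `a`** (rate-free, sign-free): there are a profile
`Φ : ℝ × ℝ → ℝ`, jointly continuous on the compact rectangle `[0, ℓ] × [0, 1/8]`, and a femto scale `ℓ > 0` such that for every `ε > 0`,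
for all large `β`, on every femto box `L·a(β) ≤ ℓ` and every admissible separation `1 ≤ n ≤ L/8`, `|u(L, β, n) − Φ(n·a(β), n/L)| ≤ ε`.
(`Φ(t, θ)` = the continuum skewness ratio at physical separation `t` in a periodic box of aspect fraction `θ`; `θ = 0` is the large-box
edge, `t = 0` the asymptotically free edge, both reached continuously.)  Identified by the wave-3 workers of stubs E_v / E_s. -/
def FemtoContinuumProfile (r : LatticeRep G) (a : ℝ → ℝ) : Prop :=
  ∃ (Φ : ℝ × ℝ → ℝ) (ℓ : ℝ), 0 < ℓ ∧ ContinuousOn Φ (Set.Icc (0 : ℝ) ℓ ×ˢ Set.Icc (0 : ℝ) 8⁻¹) ∧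
    ∀ ε : ℝ, 0 < ε → ∃ β_v : ℝ, ∀ (L : ℕ) [NeZero L] (β : ℝ) (n : ℕ), β_v ≤ β → (L : ℝ) * a β ≤ ℓ →
      1 ≤ n → 8 * n ≤ L → |skewRatioT r L β n - Φ ((n : ℝ) * a β, (n : ℝ) / L)| ≤ ε

/-- **Fixed-torus TREE DOMINANCE with a fixed relative error** (the anchor side's promotable form, identified by the wave-3 worker of
stub A): on every fixed torus `L₀ ≥ 8n₀`, eventually as `β → ∞`, the crux cumulant and the axis covariance are within relative error
`θ < 1` of the tree forms `8dλ³G_a²G_d`, `2dλ²G_a²` for SOME coupling factor `λ = λ(L₀, β, n₀) > 0` (`θ`, `d` fixed per `(G, r)`).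
No limits, no rate, no knowledge of the constant-mode (toron) law is asked: `θ` absorbs the `O((n₀/L₀)⁴)` zero-mode terms.  The
fixed-torus shadow of `PressureDominance` (there on femto boxes `L·a(β) ≤ ℓ₁`). -/
def FixedTorusTreeDominance (r : LatticeRep G) : Prop :=
  ∃ θ d : ℝ, 0 ≤ θ ∧ θ < 1 ∧ 0 < d ∧ ∀ (L₀ n₀ : ℕ) [NeZero L₀], 1 ≤ n₀ → 8 * n₀ ≤ L₀ →
    ∀ᶠ β in atTop, ∃ lam : ℝ, 0 < lam ∧
      |kappa3 r L₀ β n₀ - 8 * d * lam ^ 3 * (torusPropAxis L₀ n₀ ^ 2 * torusPropDiag L₀ n₀)| ≤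
          θ * (8 * d * lam ^ 3 * (torusPropAxis L₀ n₀ ^ 2 * torusPropDiag L₀ n₀)) ∧
      |covAxis r L₀ β n₀ - 2 * d * lam ^ 2 * torusPropAxis L₀ n₀ ^ 2| ≤
          θ * (2 * d * lam ^ 2 * torusPropAxis L₀ n₀ ^ 2)

end Forms

/-- **Profile engine** (the shape in which a femto continuum-LIMIT engine would deliver E_c ∧ E_v ∧ E_s at once): for compact simple `G`,
any `r` and any continuous package map `a₀`, SOME continuous positive map `a` dominated by `a₀` carries the femto continuum profile of the
ratio.  `ProfileEngine → RatioTransportEngineQ` (`profileEngine_engineQ`, bridges file).  NOT asserted. -/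
def ProfileEngine : Prop :=
  ∀ (G : Type) [Group G] [TopologicalSpace G] [IsTopologicalGroup G] [CompactSpace G]
    [MeasurableSpace G] [BorelSpace G], IsCompactSimpleLieGroup G →
    ∀ (r : LatticeRep G) (a₀ : ℝ → ℝ), Continuous a₀ → TwoPointPackage r a₀ →
      ∃ a : ℝ → ℝ, Continuous a ∧ (∀ β, 0 < a β) ∧ Dominated a a₀ ∧ FemtoContinuumProfile r a

/-- **Tree dominance on fixed tori at every `(G, r)` where the crux hypothesis holds** (item-level form of the anchor side;
`anchors_of_treeDominance : AnchorsTreeDominance → Anchors`, bridges file).  NOT asserted. -/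
def AnchorsTreeDominance : Prop :=
  ∀ (G : Type) [Group G] [TopologicalSpace G] [IsTopologicalGroup G] [CompactSpace G]
    [MeasurableSpace G] [BorelSpace G], IsCompactSimpleLieGroup G →
    ∀ (r : LatticeRep G), (∃ a : ℝ → ℝ, Continuous a ∧ TwoPointPackage r a) → FixedTorusTreeDominance r

end Summit.QuantumFields.YangMills.Cruxes.FemtoCurvatureSkewnessC.RatioTransport

end
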